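import Summits.AtomisticToContinuum.BoseEinsteinCondensation.Theses.BECLatticeDepthHomotopy

/-!
# Birth skeleton (BC3) for crux `LatticeOnlyDepletes` — route BECLatticeDepthHomotopy

Crux (stmt-AtomisticToContinuum-12405, rank 2, endpoint form LDM′): in the half-filled optical-lattice
setting of the route (N = 4m³ bosons, torus of side L = (N/ρ)^(1/3) = 2mb, lattice c·Σᵢ W_b(xᵢ),
Λ(c) = mode-free ground-state condensate number at depth c), `liminf_(c→∞) Λ(c) ≤ Λ(0)`.

LINE `birth` = the card's mechanism LDM ("an optical lattice only depletes") in DIFFERENTIAL /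
LOCAL form, split into its two genuinely different ingredients:

* `stub_localDepletion` (the physics; hardest stub, open-problem strength but LOCAL in the depth):
  every depth c ≥ 0 has a right-neighbourhood [c, c + ε] on which digging the lattice deeper does
  not increase the condensate number, Λ(c') ≤ Λ(c). This is the Hellmann–Feynman / cross-
  susceptibility sign dΛ/dc⁺ ≤ 0 of the route header (condensate number and lattice energy
  positively correlated through the reduced resolvent of the unique stoquastic ground state at
  fixed (N, L, c); Feynman–Kac pathwise monotonicity in W is the other proposed tool). At v = 0
  a.e. it holds with equality (Λ ≡ N: product of Bloch ground states, one-body gap at fixed m).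
  Shallow end: second-order (Bogoliubov) sign is favourable, depletion grows at O(c²)
  (arXiv:cond-mat/0601184); deep end: the surviving corrections t/U_c, t′_c/t_c → 0 both lower Λ.
* `stub_depthLowerSemicontinuous` (soft analysis, provable now, M): at fixed (m, ρ) the depth map
  c ↦ Λ(c) is lower semicontinuous on [0, ∞). Mechanism: the lattice term is a bounded one-body
  perturbation, 0 ≤ ∫ Σᵢ W_b |Ψ|² ≤ 3N, so a δ-near-minimiser at depth c' is a
  (δ + 6N|c − c'|)-near-minimiser at depth c; unpacking `⨆ δ ⨅ Ψ` gives
  Λ(c') ≥ sup_(δ' > 6N|c−c'|) inf_(δ'-near-min at c) maxOcc ↑ Λ(c) as c' → c. No ground-state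
  existence / uniqueness and no C¹-attainment is needed (the C¹ core never attains for hard cores).
* `latticeOnlyDepletes_of_stubSigs : stubA-sig → stubB-sig → (crux, unfolded one step)` (real proof, no
  sorry) and `LatticeOnlyDepletes_of : LatticeOnlyDepletes` (the crux BY NAME from the two declared
  stubs through it): continuous induction on [0, b]
  (`IsClosed.Icc_subset_of_forall_mem_nhdsWithin`): the sublevel set {c ≥ 0 | Λ c ≤ Λ 0} is closed
  by lower semicontinuity, contains 0, and is right-open inside itself by local depletion; hence
  Λ(b) ≤ Λ(0) for every b ≥ 0, so liminf_(c→∞) Λ ≤ Λ(0) (`Filter.liminf_le_of_frequently_le'`).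

Why this cut and not the regime cut (shallow [0, E_R] / deep [E_R, ∞) antitone): both halves of a
regime cut are the same claim on two ranges (a trivial seam); here the two stubs are different in
kind (a sign condition in perturbation theory at one depth vs. closedness of sublevel sets), and
the global comparison is manufactured by the glue. The endpoint crux has a factor ≈ 2 of room
(Λ(0) ≈ 0.95N vs deep limit ≤ (N+1)/2 by the hard-core bound); this line spends that room for
locality: `stub_localDepletion` is exact at every depth (a bump at intermediate depth kills the
LINE, not the crux — route KILL CRITERIA).

Disproof used: none on file (no `Disproof.lean` / Negative lemmas for this crux at registration,
`ledger crux ls` 2026-08-17); negatives index (20 items) has no statement about Λ, depth or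
maxOccupation. Stubs are stated over existing declarations only (verbatim `let`-prefix of the
route decl, so everything composes by zeta-reduction exactly as the route's `closes`).
-/

namespace Summit.AtomisticToContinuum.BoseEinsteinCondensation.Cruxes.LatticeOnlyDepletes.Birth

open scoped BigOperators Topology MeasureTheory ENNReal
open Filter Set MeasureTheory

/-- GLUE LEMMA (pure real analysis, sorry-free): a function `f : ℝ → ℝ≥0∞` that is lower
semicontinuous on `[0, ∞)` and locally non-increasing to the right of every point of `[0, ∞)`
satisfies `f b ≤ f 0` for all `b ≥ 0`; in particular `liminf_(c→∞) f ≤ f 0`. -/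
theorem le_init_of_localAntitone_of_lsc (f : ℝ → ℝ≥0∞)
    (hA : ∀ c : ℝ, 0 ≤ c → ∃ ε : ℝ, 0 < ε ∧ ∀ c' : ℝ, c ≤ c' → c' ≤ c + ε → f c' ≤ f c)
    (hB : LowerSemicontinuousOn f (Set.Ici 0)) :
    ∀ b : ℝ, 0 ≤ b → f b ≤ f 0 := by
  intro b hb
  obtain ⟨w, hw, hEq⟩ := lowerSemicontinuousOn_iff_preimage_Iic.1 hB (f 0)
  have h1 : IsClosed (Set.Ici (0 : ℝ) ∩ f ⁻¹' Set.Iic (f 0)) := by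
    rw [hEq]; exact isClosed_Ici.inter hw
  have hcl : IsClosed ({x : ℝ | f x ≤ f 0} ∩ Set.Icc 0 b) := by
    have : {x : ℝ | f x ≤ f 0} ∩ Set.Icc 0 b = (Set.Ici 0 ∩ f ⁻¹' Set.Iic (f 0)) ∩ Set.Icc 0 b := by
      ext x
      simp only [Set.mem_inter_iff, Set.mem_setOf_eq, Set.mem_Ici, Set.mem_preimage, Set.mem_Iic,
        Set.mem_Icc]
      tauto
    rw [this]
    exact h1.inter isClosed_Icc
  have hsub : Set.Icc 0 b ⊆ {x : ℝ | f x ≤ f 0} := by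
    refine hcl.Icc_subset_of_forall_mem_nhdsWithin (show f 0 ≤ f 0 from le_rfl) ?_
    rintro x ⟨hx, hx0, -⟩
    have hx' : f x ≤ f 0 := hx
    obtain ⟨ε, hε, hεA⟩ := hA x hx0
    filter_upwards [Ioc_mem_nhdsGT (show x < x + ε by linarith)] with c' hc'
    exact (hεA c' hc'.1.le hc'.2).trans hx'
  exact hsub ⟨hb, le_rfl⟩

/-- Corollary of the glue lemma in the `liminf` form of the crux. -/
theorem liminf_le_init_of_localAntitone_of_lsc (f : ℝ → ℝ≥0∞)
    (hA : ∀ c : ℝ, 0 ≤ c → ∃ ε : ℝ, 0 < ε ∧ ∀ c' : ℝ, c ≤ c' → c' ≤ c + ε → f c' ≤ f c)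
    (hB : LowerSemicontinuousOn f (Set.Ici 0)) :
    Filter.liminf f Filter.atTop ≤ f 0 := by
  have hev : ∀ᶠ c in Filter.atTop, f c ≤ f 0 :=
    (Filter.eventually_ge_atTop (0 : ℝ)).mono (le_init_of_localAntitone_of_lsc f hA hB)
  exact Filter.liminf_le_of_frequently_le' hev.frequently

/-- STUB A — LOCAL DEPLETION (hardest; the LDM mechanism in differential form). For every repulsive
finite-range `v` there is `ρ₁ > 0` such that for all large `m` and all `0 < ρ < ρ₁`, in the route's
setting, every depth `c ≥ 0` has a right-neighbourhood `[c, c + ε]` (ε may depend on everything)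
on which the mode-free ground-state condensate number does not increase: `Λ c' ≤ Λ c`.
Expected proof: uniqueness + positivity of the periodic ground state of `H_c = H_0 + c W_N`
(stoquastic, `W_N` bounded), `Λ(c) = λ_max(γ_c)` by the fixed-(N,L,c) gap, analytic perturbation
theory in `c`, and the SIGN of the cross-susceptibility `dλ_max/dc = -2 Re⟨δN_φ R_c W_N⟩ ≤ 0`
(resp. of the first non-vanishing derivative; at `c = 0` the family is even in `c`). -/
theorem stub_localDepletion :
    ∀ v : ℝ → ENNReal, Literature.MathematicalPhysics.QuantumManyBody.BoseGas.IsRepulsiveFiniteRange v → ∃ ρ₁ : ℝ, 0 < ρ₁ ∧ ∀ᶠ m : ℕ in Filter.atTop, ∀ ρ : ℝ, 0 < ρ → ρ < ρ₁ → (let N : ℕ := 4 * m ^ 3; let L : ℝ := Literature.MathematicalPhysics.QuantumManyBody.BoseGas.sideLength ρ N; let E : ℝ → Literature.MathematicalPhysics.QuantumManyBody.BoseGas.PeriodicTrialState N L → ENNReal := fun c Ψ => Literature.MathematicalPhysics.QuantumManyBody.BoseGas.periodicEnergy v Ψ + ENNReal.ofReal c * ∫⁻ X in Literature.MathematicalPhysics.QuantumManyBody.BoseGas.cellN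 N L, ENNReal.ofReal (∑ i, ∑ k : Fin 3, Real.sin (Real.pi * (X i) k * (2 * (m : ℝ)) / L) ^ 2) * (‖Ψ.ψ X‖₊ : ENNReal) ^ 2; let Λ : ℝ → ENNReal := fun c => ⨆ (δ : ENNReal) (_ : 0 < δ), ⨅ (Ψ : Literature.MathematicalPhysics.QuantumManyBody.BoseGas.PeriodicTrialState N L) (_ : E c Ψ ≤ (⨅ Φ : Literature.MathematicalPhysics.QuantumManyBody.BoseGas.PeriodicTrialState N L, E c Φ) + δ), Literature.MathematicalPhysics.QuantumManyBody.BoseGas.maxOccupation N ((Literature.MathematicalPhysics.QuantumManyBody.BoseGas.cellN N L).indicator Ψ.ψ); ∀ c : ℝ, 0 ≤ c → ∃ ε : ℝ, 0 < ε ∧ ∀ c' : ℝ, c ≤ c' → c' ≤ c + ε → Λ c' ≤ Λ c) := by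
  sorry

/-- STUB B — DEPTH LOWER SEMICONTINUITY (soft, M). For every repulsive finite-range `v` there is
`ρ₁ > 0` such that for all large `m` and all `0 < ρ < ρ₁`, the depth map `c ↦ Λ(c)` is lower
semicontinuous on `[0, ∞)`. Expected proof: `0 ≤ ∫ Σᵢ W_b |Ψ|² ≤ 3N` (by `norm_eq`), hence
δ-near-minimisers at depth `c'` are `(δ + 6N|c - c'|)`-near-minimisers at depth `c`, and the
`⨆ δ ⨅ Ψ` functional at `c'` dominates `⨆_(δ' > 6N|c-c'|) ⨅` at `c`, which increases to `Λ c`. -/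
theorem stub_depthLowerSemicontinuous :
    ∀ v : ℝ → ENNReal, Literature.MathematicalPhysics.QuantumManyBody.BoseGas.IsRepulsiveFiniteRange v → ∃ ρ₁ : ℝ, 0 < ρ₁ ∧ ∀ᶠ m : ℕ in Filter.atTop, ∀ ρ : ℝ, 0 < ρ → ρ < ρ₁ → (let N : ℕ := 4 * m ^ 3; let L : ℝ := Literature.MathematicalPhysics.QuantumManyBody.BoseGas.sideLength ρ N; let E : ℝ → Literature.MathematicalPhysics.QuantumManyBody.BoseGas.PeriodicTrialState N L → ENNReal := fun c Ψ => Literature.MathematicalPhysics.QuantumManyBody.BoseGas.periodicEnergy v Ψ + ENNReal.ofReal c * ∫⁻ X in Literature.MathematicalPhysics.QuantumManyBody.BoseGas.cellN N L, ENNReal.ofReal (∑ i, ∑ k : Fin 3, Real.sin (Real.pi * (X i) k * (2 * (m : ℝ)) / L) ^ 2) * (‖Ψ.ψ X‖₊ : ENNReal) ^ 2; let Λ : ℝ → ENNReal := fun c => ⨆ (δ : ENNReal) (_ : 0 < δ), ⨅ (Ψ : Literature.MathematicalPhysics.QuantumManyBody.BoseGas.PeriodicTrialState N L) (_ : E c Ψ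 ≤ (⨅ Φ : Literature.MathematicalPhysics.QuantumManyBody.BoseGas.PeriodicTrialState N L, E c Φ) + δ), Literature.MathematicalPhysics.QuantumManyBody.BoseGas.maxOccupation N ((Literature.MathematicalPhysics.QuantumManyBody.BoseGas.cellN N L).indicator Ψ.ψ); LowerSemicontinuousOn Λ (Set.Ici 0)) := by
  sorry

/-- COMPOSITION WITH EXPLICIT HYPOTHESES (the BC3 shape `stub₁-sig → stub₂-sig → crux`, the conclusion
written as the crux's one-step unfolding so that `LatticeOnlyDepletes_of` below is the file's ONLY
theorem whose head is the crux name, as `ledger skeleton check` requires). Sorry-free, standard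
axioms: zeta-reduce the shared `let`-prefix (`dsimp only`, exactly as the route's `closes`), then
the glue lemma `liminf_le_init_of_localAntitone_of_lsc`. -/
theorem latticeOnlyDepletes_of_stubSigs
    (hA : ∀ v : ℝ → ENNReal, Literature.MathematicalPhysics.QuantumManyBody.BoseGas.IsRepulsiveFiniteRange v → ∃ ρ₁ : ℝ, 0 < ρ₁ ∧ ∀ᶠ m : ℕ in Filter.atTop, ∀ ρ : ℝ, 0 < ρ → ρ < ρ₁ → (let N : ℕ := 4 * m ^ 3; let L : ℝ := Literature.MathematicalPhysics.QuantumManyBody.BoseGas.sideLength ρ N; let E : ℝ → Literature.MathematicalPhysics.QuantumManyBody.BoseGas.PeriodicTrialState N L → ENNReal := fun c Ψ => Literature.MathematicalPhysics.QuantumManyBody.BoseGas.periodicEnergy v Ψ + ENNReal.ofReal c * ∫⁻ X in Literature.MathematicalPhysics.QuantumManyBody.BoseGas.cellN N L, ENNReal.ofReal (∑ i, ∑ k : Fin 3, Real.sin (Real.pi * (X i) k * (2 * (m : ℝ)) / L) ^ 2) * (‖Ψ.ψ X‖₊ : ENNReal) ^ 2; let Λ : ℝ → ENNReal := fun c =>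 ⨆ (δ : ENNReal) (_ : 0 < δ), ⨅ (Ψ : Literature.MathematicalPhysics.QuantumManyBody.BoseGas.PeriodicTrialState N L) (_ : E c Ψ ≤ (⨅ Φ : Literature.MathematicalPhysics.QuantumManyBody.BoseGas.PeriodicTrialState N L, E c Φ) + δ), Literature.MathematicalPhysics.QuantumManyBody.BoseGas.maxOccupation N ((Literature.MathematicalPhysics.QuantumManyBody.BoseGas.cellN N L).indicator Ψ.ψ); ∀ c : ℝ, 0 ≤ c → ∃ ε : ℝ, 0 < ε ∧ ∀ c' : ℝ, c ≤ c' → c' ≤ c + ε → Λ c' ≤ Λ c))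
    (hB : ∀ v : ℝ → ENNReal, Literature.MathematicalPhysics.QuantumManyBody.BoseGas.IsRepulsiveFiniteRange v → ∃ ρ₁ : ℝ, 0 < ρ₁ ∧ ∀ᶠ m : ℕ in Filter.atTop, ∀ ρ : ℝ, 0 < ρ → ρ < ρ₁ → (let N : ℕ := 4 * m ^ 3; let L : ℝ := Literature.MathematicalPhysics.QuantumManyBody.BoseGas.sideLength ρ N; let E : ℝ → Literature.MathematicalPhysics.QuantumManyBody.BoseGas.PeriodicTrialState N L → ENNReal := fun c Ψ => Literature.MathematicalPhysics.QuantumManyBody.BoseGas.periodicEnergy v Ψ + ENNReal.ofReal c * ∫⁻ X in Literature.MathematicalPhysics.QuantumManyBody.BoseGas.cellN N L, ENNReal.ofReal (∑ i, ∑ k : Fin 3, Real.sin (Real.pi * (X i) k * (2 * (m : ℝ)) / L) ^ 2) * (‖Ψ.ψ X‖₊ : ENNReal) ^ 2; let Λ : ℝ → ENNReal := fun c => ⨆ (δ : ENNReal) (_ : 0 < δ), ⨅ (Ψ : Literature.MathematicalPhysics.QuantumManyBody.BoseGas.PeriodicTrialState N L) (_ : E c Ψ ≤ (⨅ Φ :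 Literature.MathematicalPhysics.QuantumManyBody.BoseGas.PeriodicTrialState N L, E c Φ) + δ), Literature.MathematicalPhysics.QuantumManyBody.BoseGas.maxOccupation N ((Literature.MathematicalPhysics.QuantumManyBody.BoseGas.cellN N L).indicator Ψ.ψ); LowerSemicontinuousOn Λ (Set.Ici 0))) :
    ∀ v : ℝ → ENNReal, Literature.MathematicalPhysics.QuantumManyBody.BoseGas.IsRepulsiveFiniteRange v → ∃ ρ₁ : ℝ, 0 < ρ₁ ∧ ∀ᶠ m : ℕ in Filter.atTop, ∀ ρ : ℝ, 0 < ρ → ρ < ρ₁ → (let N : ℕ := 4 * m ^ 3; let L : ℝ := Literature.MathematicalPhysics.QuantumManyBody.BoseGas.sideLength ρ N; let E : ℝ → Literature.MathematicalPhysics.QuantumManyBody.BoseGas.PeriodicTrialState N L → ENNReal := fun c Ψ => Literature.MathematicalPhysics.QuantumManyBody.BoseGas.periodicEnergy v Ψ + ENNReal.ofReal c * ∫⁻ X in Literature.MathematicalPhysics.QuantumManyBody.BoseGas.cellN N L, ENNReal.ofReal (∑ i, ∑ k : Fin 3, Real.sin (Real.pi * (X i) k * (2 * (m : ℝ)) /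 L) ^ 2) * (‖Ψ.ψ X‖₊ : ENNReal) ^ 2; let Λ : ℝ → ENNReal := fun c => ⨆ (δ : ENNReal) (_ : 0 < δ), ⨅ (Ψ : Literature.MathematicalPhysics.QuantumManyBody.BoseGas.PeriodicTrialState N L) (_ : E c Ψ ≤ (⨅ Φ : Literature.MathematicalPhysics.QuantumManyBody.BoseGas.PeriodicTrialState N L, E c Φ) + δ), Literature.MathematicalPhysics.QuantumManyBody.BoseGas.maxOccupation N ((Literature.MathematicalPhysics.QuantumManyBody.BoseGas.cellN N L).indicator Ψ.ψ); Filter.liminf Λ Filter.atTop ≤ Λ 0) := by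
  intro v hv
  obtain ⟨ρa, ha, hA⟩ := hA v hv
  obtain ⟨ρb, hb, hB⟩ := hB v hv
  refine ⟨min ρa ρb, lt_min ha hb, ?_⟩
  filter_upwards [hA, hB] with m hA hB
  intro ρ hρ hρ₁
  have h1 := hA ρ hρ (lt_of_lt_of_le hρ₁ (min_le_left _ _))
  have h2 := hB ρ hρ (lt_of_lt_of_le hρ₁ (min_le_right _ _))
  dsimp only at h1 h2 ⊢
  exact liminf_le_init_of_localAntitone_of_lsc _ h1 h2

/-- THE SKELETON THEOREM: the crux `LatticeOnlyDepletes` BY NAME from the two DECLARED stubs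
`stub_localDepletion` and `stub_depthLowerSemicontinuous` (the only `sorry`s of the file) through
the sorry-free composition `latticeOnlyDepletes_of_stubSigs` (one-step unfolding of the route
`def`, closed by `exact` up to delta). -/
theorem LatticeOnlyDepletes_of :
    Summit.AtomisticToContinuum.BoseEinsteinCondensation.Theses.BECLatticeDepthHomotopy.LatticeOnlyDepletes :=
  latticeOnlyDepletes_of_stubSigs stub_localDepletion stub_depthLowerSemicontinuous

end Summit.AtomisticToContinuum.BoseEinsteinCondensation.Cruxes.LatticeOnlyDepletes.Birth
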